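import Summits.CriticalPhenomena.PercolationContinuityZ3.Theorems.FK.PressureElementaryBounds
import Summits.CriticalPhenomena.PercolationContinuityZ3.Theorems.FK.FieldEnergyBounds
import Summits.CriticalPhenomena.PercolationContinuityZ3.Theorems.FK.PressureFieldDerivative
import HarnessLib

/-!
# THE ISING PRESSURE SURFACE IS GLOBALLY LIPSCHITZ: `|ψ(β,h₁) − ψ(β,h₂)| ≤ |β| |h₁ − h₂|`,
# `|ψ(β₁,h) − ψ(β₂,h)| ≤ (d + |h|) |β₁ − β₂|`, jointly continuous on ALL of `ℝ²`, nondecreasing in `β ≥ 0` and in `|h|`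
# (Friedli–Velenik 2017, Thm. 3.6 (proof), Lemma 3.5, Exercise 3.3; Ruelle 1969, §2.6)

Claimed R42 (8)(c) in the cell INBOX at 2026-08-29T04:48:56Z by fkp-10a gen 358 (NEW CLAIM #2 of the gen), addressed to coordinator fk-4 gen 292 (seated 04:05Z 2026-08-29 by l.8710; R166 in force); lineage row FO-10a-g358l (self-suggested), package g358-lipschitz, label LZ-A.
Helper file of the `fk-continuity` build cell (bschramm lane; `--supports stmt-CriticalPhenomena-4575`); builds on
p205010 (kernel theorem, internal audit signed; external expert review pending). No definitions, no named facts, no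
sorries; standard axioms. UNCONDITIONAL (nearest-neighbour Ising model on `ℤ^d`, every `d`; finite-volume part on any
locally finite graph with any boundary condition and ALL real `β`, `h`).

The comparison principle `|log Σ e^f − log Σ e^g| ≤ sup |f − g|` (Literature `abs_log_sum_exp_sub_le`) applied to
`f = −β₁H_{h₁}`, `g = −β₂H_{h₂}`:

* `abs_log_isingPartitionFunction_sub_le_field` — `|log Z_{Λ;β,h₁} − log Z_{Λ;β,h₂}| ≤ |β| |h₁ − h₂| |Λ|`;
  `abs_log_isingPartitionFunction_sub_le_beta` — `|log Z_{Λ;β₁,h} − log Z_{Λ;β₂,h}| ≤ |β₁ − β₂| (|ℰ^{bc}_Λ| + |h||Λ|)`;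
* **`abs_pressure_sub_pressure_le_field`** — `|ψ(β,h₁) − ψ(β,h₂)| ≤ |β| |h₁ − h₂|` (all real `β, h₁, h₂`);
  **`abs_pressure_sub_pressure_le_beta`** — `|ψ(β₁,h) − ψ(β₂,h)| ≤ (d + |h|) |β₁ − β₂|` (all real `β₁, β₂, h`);
  **`abs_pressure_sub_pressure_le`** — the joint estimate `|ψ(β₁,h₁) − ψ(β₂,h₂)| ≤ (d + |h₁|)|β₁ − β₂| + |β₂||h₁ − h₂|`;
* **`continuous_pressure_uncurry`** — `(β,h) ↦ ψ(β,h)` is continuous on ALL of `ℝ × ℝ` (the convexity argument of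
  `PressureJointConvexity` gives it on `{β > 0}` only); `lipschitzOnWith_pressure_uncurry` — Lipschitz on every
  bounded rectangle `[−B,B] × [−K,K]` with constant `d + K + B` (sup metric);
* `monotoneOn_pressure_beta_field` — `β ↦ ψ(β,h)` is nondecreasing on `[0,∞)` for EVERY `h` (chords
  `≥ Σᵢ⟨σ_0σ_{eᵢ}⟩⁺ + |h|⟨σ_0⟩⁺ ≥ 0`); `monotoneOn_pressure_field_abs` — `h ↦ ψ(β,h)` is nondecreasing on `[0,∞)` and
  `pressure_le_pressure_of_abs_le` — `ψ(β,h₁) ≤ ψ(β,h₂)` whenever `|h₁| ≤ |h₂|` (convex and even in `h`).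

## References

* S. Friedli, Y. Velenik, *Statistical Mechanics of Lattice Systems*, CUP (2017), Lemma 3.5, Thm. 3.6 and its proof,
  Exercise 3.3, §3.7.1. [FriedliVelenik2017]
* D. Ruelle, *Statistical Mechanics: Rigorous Results*, Benjamin (1969), §2.6 (the pressure is Lipschitz in the
  interaction). [Ruelle1969]
-/

noncomputable section

namespace Summit.CriticalPhenomena.PercolationContinuityZ3.Theorems.FK

namespace IsingPressure

open MeasureTheory Filter Topology Finset Set
open Literature.Probability.LatticeModels
open Summit.CriticalPhenomena.PercolationContinuityZ3.Theorems.FK.IsingEnergyDensity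
open Summit.CriticalPhenomena.PercolationContinuityZ3.Theorems.FK.IsingSusceptibility

variable {d : ℕ}

/-! ### Finite volume: comparison of partition functions -/

section FiniteVolume

variable {V : Type*} (G : SimpleGraph V) [DecidableEq V] [G.LocallyFinite]

/-- **`|log Z^{bc}_{Λ;β,h₁} − log Z^{bc}_{Λ;β,h₂}| ≤ |β| |h₁ − h₂| |Λ|`** (the energies differ by `βΔh Σ_x σ_x`).
[cite: FriedliVelenik2017, Thm. 3.6 (proof) and Lemma 3.5] -/
theorem abs_log_isingPartitionFunction_sub_le_field (Λ : Finset V) (β h₁ h₂ : ℝ) (bc : BoundaryCondition V) :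
    |Real.log (isingPartitionFunction G Λ β h₁ bc) - Real.log (isingPartitionFunction G Λ β h₂ bc)| ≤
      |β| * |h₁ - h₂| * #Λ := by
  have inst : Nonempty (Λ → ℤˣ) := ⟨fun _ => 1⟩
  rw [isingPartitionFunction_eq_sum_exp, isingPartitionFunction_eq_sum_exp]
  refine abs_log_sum_exp_sub_le fun τ => ?_
  have hH : -β * isingHamiltonian G Λ h₁ bc (glue Λ τ bc) - -β * isingHamiltonian G Λ h₂ bc (glue Λ τ bc) =
      β * (h₁ - h₂) * ∑ x ∈ Λ, spinAt x (glue Λ τ bc) := by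
    unfold isingHamiltonian; ring
  rw [hH, abs_mul, abs_mul]
  exact mul_le_mul_of_nonneg_left (abs_sum_spinAt_le _ _) (by positivity)

/-- **`|log Z^{bc}_{Λ;β₁,h} − log Z^{bc}_{Λ;β₂,h}| ≤ |β₁ − β₂| (|ℰ^{bc}_Λ| + |h| |Λ|)`** (`|H| ≤ |ℰ| + |h||Λ|`).
[cite: FriedliVelenik2017, Thm. 3.6 (proof) and Lemma 3.5] -/
theorem abs_log_isingPartitionFunction_sub_le_beta (Λ : Finset V) (β₁ β₂ h : ℝ) (bc : BoundaryCondition V) :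
    |Real.log (isingPartitionFunction G Λ β₁ h bc) - Real.log (isingPartitionFunction G Λ β₂ h bc)| ≤
      |β₁ - β₂| * (#(interactionEdges G Λ bc) + |h| * #Λ) := by
  have inst : Nonempty (Λ → ℤˣ) := ⟨fun _ => 1⟩
  rw [isingPartitionFunction_eq_sum_exp, isingPartitionFunction_eq_sum_exp]
  refine abs_log_sum_exp_sub_le fun τ => ?_
  have hH : -β₁ * isingHamiltonian G Λ h bc (glue Λ τ bc) - -β₂ * isingHamiltonian G Λ h bc (glue Λ τ bc) =
      (β₂ - β₁) * isingHamiltonian G Λ h bc (glue Λ τ bc) := by ring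
  rw [hH, abs_mul, abs_sub_comm β₂ β₁]
  refine mul_le_mul_of_nonneg_left ?_ (abs_nonneg _)
  -- `|H| ≤ |ℰ^{bc}| + |h||Λ|`
  unfold isingHamiltonian
  calc |-(∑ e ∈ interactionEdges G Λ bc, bondSpin (glue Λ τ bc) e) - h * ∑ x ∈ Λ, spinAt x (glue Λ τ bc)|
      ≤ |-(∑ e ∈ interactionEdges G Λ bc, bondSpin (glue Λ τ bc) e)| + |h * ∑ x ∈ Λ, spinAt x (glue Λ τ bc)| :=
        abs_sub _ _
    _ ≤ #(interactionEdges G Λ bc) + |h| * #Λ := by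
        rw [abs_neg, abs_mul]
        exact add_le_add (abs_sum_bondSpin_le _ _) (mul_le_mul_of_nonneg_left (abs_sum_spinAt_le _ _) (abs_nonneg h))

end FiniteVolume

/-! ### Infinite volume: the two Lipschitz estimates -/

/-- **`|ψ(β,h₁) − ψ(β,h₂)| ≤ |β| |h₁ − h₂|`** for all real `β, h₁, h₂`: the pressure is `|β|`-Lipschitz in the field.
[cite: FriedliVelenik2017, Thm. 3.6 and Lemma 3.5; Ruelle1969, §2.6] -/
theorem abs_pressure_sub_pressure_le_field (β h₁ h₂ : ℝ) :
    |pressure d β h₁ - pressure d β h₂| ≤ |β| * |h₁ - h₂| := by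
  have hlim : Tendsto (fun L : ℕ => pressureIn (zdGraph d) (box d L) β h₁ .free - pressureIn (zdGraph d) (box d L) β h₂ .free)
      atTop (𝓝 (pressure d β h₁ - pressure d β h₂)) :=
    (hasBoxLimit_pressureIn_holds (d := d) β h₁ .free).sub (hasBoxLimit_pressureIn_holds (d := d) β h₂ .free)
  refine le_of_tendsto ((continuous_abs.tendsto _).comp hlim) (Eventually.of_forall fun L => ?_)
  have hpos : (0 : ℝ) < #(box d L) := by exact_mod_cast (box_nonempty d L).card_pos
  simp only [Function.comp_apply, pressureIn, ← sub_div, abs_div, abs_of_pos hpos, div_le_iff₀ hpos]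
  exact abs_log_isingPartitionFunction_sub_le_field (zdGraph d) (box d L) β h₁ h₂ .free

/-- **`|ψ(β₁,h) − ψ(β₂,h)| ≤ (d + |h|) |β₁ − β₂|`** for all real `β₁, β₂, h`: the pressure is `(d + |h|)`-Lipschitz in the
inverse temperature (`|E_{Λ_L}|/|Λ_L| → d`). [cite: FriedliVelenik2017, Thm. 3.6 (proof); Ruelle1969, §2.6] -/
theorem abs_pressure_sub_pressure_le_beta (β₁ β₂ h : ℝ) :
    |pressure d β₁ h - pressure d β₂ h| ≤ (d + |h|) * |β₁ - β₂| := by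
  have hlim : Tendsto (fun L : ℕ => pressureIn (zdGraph d) (box d L) β₁ h .free - pressureIn (zdGraph d) (box d L) β₂ h .free)
      atTop (𝓝 (pressure d β₁ h - pressure d β₂ h)) :=
    (hasBoxLimit_pressureIn_holds (d := d) β₁ h .free).sub (hasBoxLimit_pressureIn_holds (d := d) β₂ h .free)
  have hup : Tendsto (fun L : ℕ => |β₁ - β₂| * ((#(edgesIn (zdGraph d) (box d L)) : ℝ) / #(box d L) + |h|)) atTop
      (𝓝 (|β₁ - β₂| * (d + |h|))) :=
    ((tendsto_card_edgesIn_box_div_card_box (d := d)).add tendsto_const_nhds).const_mul _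
  have := le_of_tendsto_of_tendsto' ((continuous_abs.tendsto _).comp hlim) hup fun L => by
    have hpos : (0 : ℝ) < #(box d L) := by exact_mod_cast (box_nonempty d L).card_pos
    simp only [Function.comp_apply, pressureIn, ← sub_div, abs_div, abs_of_pos hpos]
    rw [div_le_iff₀ hpos]
    have h1 := abs_log_isingPartitionFunction_sub_le_beta (zdGraph d) (box d L) β₁ β₂ h .free
    rw [interactionEdges_free] at h1
    calc |Real.log (isingPartitionFunction (zdGraph d) (box d L) β₁ h .free) -
          Real.log (isingPartitionFunction (zdGraph d) (box d L) β₂ h .free)|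
        ≤ |β₁ - β₂| * (#(edgesIn (zdGraph d) (box d L)) + |h| * #(box d L)) := h1
      _ = |β₁ - β₂| * ((#(edgesIn (zdGraph d) (box d L)) : ℝ) / #(box d L) + |h|) * #(box d L) := by
          field_simp
  linarith [mul_comm |β₁ - β₂| ((d : ℝ) + |h|)]

/-- **The joint Lipschitz estimate**: `|ψ(β₁,h₁) − ψ(β₂,h₂)| ≤ (d + |h₁|)|β₁ − β₂| + |β₂| |h₁ − h₂|` (all real
parameters). [cite: FriedliVelenik2017, Thm. 3.6; Ruelle1969, §2.6] -/
theorem abs_pressure_sub_pressure_le (β₁ h₁ β₂ h₂ : ℝ) :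
    |pressure d β₁ h₁ - pressure d β₂ h₂| ≤ (d + |h₁|) * |β₁ - β₂| + |β₂| * |h₁ - h₂| := by
  have h1 := abs_pressure_sub_pressure_le_beta (d := d) β₁ β₂ h₁
  have h2 := abs_pressure_sub_pressure_le_field (d := d) β₂ h₁ h₂
  calc |pressure d β₁ h₁ - pressure d β₂ h₂|
      = |(pressure d β₁ h₁ - pressure d β₂ h₁) + (pressure d β₂ h₁ - pressure d β₂ h₂)| := by ring_nf
    _ ≤ |pressure d β₁ h₁ - pressure d β₂ h₁| + |pressure d β₂ h₁ - pressure d β₂ h₂| := abs_add_le _ _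
    _ ≤ _ := add_le_add h1 h2

/-! ### Joint continuity on the whole plane; Lipschitz on bounded rectangles -/

/-- **`(β,h) ↦ ψ(β,h)` IS CONTINUOUS ON ALL OF `ℝ × ℝ`** (including `β ≤ 0`), from the joint Lipschitz estimate.
[cite: FriedliVelenik2017, Thm. 3.6; Ruelle1969, §2.6] -/
theorem continuous_pressure_uncurry : Continuous fun p : ℝ × ℝ => pressure d p.1 p.2 := by
  refine continuous_iff_continuousAt.2 fun p => ?_
  rw [Metric.continuousAt_iff]
  intro ε hε
  -- on the ball of radius `1` around `p` the Lipschitz constant is at most `K = d + |p.2| + 1 + |p.1| + 1`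
  set K : ℝ := (d + (|p.2| + 1)) + (|p.1| + 1) with hK
  have hK0 : 0 < K := by positivity
  refine ⟨min 1 (ε / K), lt_min one_pos (div_pos hε hK0), fun q hq => ?_⟩
  have hq1 : dist q p < 1 := lt_of_lt_of_le hq (min_le_left _ _)
  have hqε : dist q p < ε / K := lt_of_lt_of_le hq (min_le_right _ _)
  rw [Prod.dist_eq] at hq1 hqε
  have hb : |q.1 - p.1| < 1 := by have := (max_lt_iff.1 hq1).1; rwa [Real.dist_eq] at this
  have hb' : |q.1 - p.1| ≤ max (dist q.1 p.1) (dist q.2 p.2) := by rw [Real.dist_eq]; exact le_max_left _ _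
  have hh' : |q.2 - p.2| ≤ max (dist q.1 p.1) (dist q.2 p.2) := by rw [Real.dist_eq (x := q.2)]; exact le_max_right _ _
  have hq2 : |q.2| ≤ |p.2| + 1 := by
    have := (max_lt_iff.1 hq1).2; rw [Real.dist_eq] at this
    have := abs_sub_abs_le_abs_sub q.2 p.2; linarith
  have hq1' : |q.1| ≤ |p.1| + 1 := by have := abs_sub_abs_le_abs_sub q.1 p.1; linarith
  rw [Real.dist_eq]
  have hmain := abs_pressure_sub_pressure_le (d := d) q.1 q.2 p.1 p.2
  have hδK : max (dist q.1 p.1) (dist q.2 p.2) * K < ε := by rwa [lt_div_iff₀ hK0] at hqε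
  calc |pressure d q.1 q.2 - pressure d p.1 p.2|
      ≤ (d + |q.2|) * |q.1 - p.1| + |p.1| * |q.2 - p.2| := hmain
    _ ≤ (d + (|p.2| + 1)) * max (dist q.1 p.1) (dist q.2 p.2) + (|p.1| + 1) * max (dist q.1 p.1) (dist q.2 p.2) := by
        gcongr
        · linarith [abs_nonneg p.1]
    _ = max (dist q.1 p.1) (dist q.2 p.2) * K := by rw [hK]; ring
    _ < ε := hδK

/-- **`ψ` is Lipschitz on every bounded rectangle**: on `[−B,B] × [−C,C]` (`B, C ≥ 0`), for the sup distance of `ℝ × ℝ`,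
`|ψ(q) − ψ(p)| ≤ (d + C + B) dist(q,p)`. [cite: FriedliVelenik2017, Thm. 3.6; Ruelle1969, §2.6] -/
theorem lipschitzOnWith_pressure_uncurry {B C : ℝ} (hB : 0 ≤ B) (hC : 0 ≤ C) :
    LipschitzOnWith (Real.toNNReal (d + C + B)) (fun p : ℝ × ℝ => pressure d p.1 p.2) (Icc (-B) B ×ˢ Icc (-C) C) := by
  refine LipschitzOnWith.of_dist_le_mul fun q hq p hp => ?_
  rw [Real.coe_toNNReal _ (by positivity), Real.dist_eq, Prod.dist_eq, Real.dist_eq, Real.dist_eq]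
  obtain ⟨hq1, hq2⟩ := mem_prod.1 hq
  obtain ⟨hp1, _⟩ := mem_prod.1 hp
  have hq2' : |q.2| ≤ C := abs_le.2 ⟨by linarith [hq2.1], hq2.2⟩
  have hp1' : |p.1| ≤ B := abs_le.2 ⟨by linarith [hp1.1], hp1.2⟩
  calc |pressure d q.1 q.2 - pressure d p.1 p.2|
      ≤ (d + |q.2|) * |q.1 - p.1| + |p.1| * |q.2 - p.2| := abs_pressure_sub_pressure_le (d := d) q.1 q.2 p.1 p.2
    _ ≤ (d + C) * max |q.1 - p.1| |q.2 - p.2| + B * max |q.1 - p.1| |q.2 - p.2| := by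
        gcongr
        · exact le_max_left _ _
        · exact le_max_right _ _
    _ = (d + C + B) * max |q.1 - p.1| |q.2 - p.2| := by ring

/-! ### Monotonicity in `β` (every field) and in `|h|` -/

/-- **`β ↦ ψ(β,h)` IS NONDECREASING ON `[0,∞)` FOR EVERY `h`** (its chords there are
`≥ Σᵢ⟨σ_0σ_{eᵢ}⟩⁺_{β',|h|} + |h|⟨σ_0⟩⁺_{β',|h|} ≥ 0` by GKS; `ψ(β,−h) = ψ(β,h)`). The tree's `monotoneOn_pressure_beta` is
the case `h = 0`. [cite: FriedliVelenik2017, Exercise 3.12 and Thm. 3.6] -/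
theorem monotoneOn_pressure_beta_field (h : ℝ) : MonotoneOn (fun b => pressure d b h) (Ici 0) := by
  -- reduce to `h ≥ 0`
  suffices H : ∀ {t : ℝ}, 0 ≤ t → MonotoneOn (fun b => pressure d b t) (Ici 0) by
    rcases le_or_gt 0 h with hh | hh
    · exact H hh
    · have hfun : (fun b => pressure d b h) = fun b => pressure d b (-h) := funext fun b => (pressure_neg_field b h).symm
      rw [hfun]
      exact H (neg_nonneg.2 hh.le)
  intro t ht a ha b _ hab
  rcases hab.eq_or_lt with rfl | hlt
  · exact le_rfl
  have h1 := (slope_pressure_beta_mem_Icc_field (d := d) (mem_Ici.1 ha) hlt ht).1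
  rw [slope_def_field, le_div_iff₀ (sub_pos.2 hlt)] at h1
  have h0 : 0 ≤ ∑ i, plusCorr d a t {0, Pi.single i 1} + t * plusCorr d a t {0} :=
    add_nonneg (sum_nonneg fun i _ => plusCorr_nonneg (mem_Ici.1 ha) ht _)
      (mul_nonneg ht (plusCorr_nonneg (mem_Ici.1 ha) ht _))
  dsimp only
  nlinarith

/-- **`h ↦ ψ(β,h)` is nondecreasing on `[0,∞)`** (every real `β`): a convex even function of `h`.
[cite: FriedliVelenik2017, Thm. 3.6, Lemma 3.5 and §3.7.1] -/
theorem monotoneOn_pressure_field_abs (β : ℝ) : MonotoneOn (fun t => pressure d β t) (Ici 0) := by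
  intro s hs t _ hst
  rcases hst.eq_or_lt with rfl | hlt
  · exact le_rfl
  have hs0 : 0 ≤ s := hs
  have ht0 : 0 < t := lt_of_le_of_lt hs0 hlt
  -- `s` is a convex combination of `-t` and `t`
  have hconv := (convexOn_pressure_field (d := d) β).2 (mem_univ (-t)) (mem_univ t)
    (show (0 : ℝ) ≤ (t - s) / (2 * t) by apply div_nonneg <;> linarith)
    (show (0 : ℝ) ≤ (t + s) / (2 * t) by apply div_nonneg <;> linarith)
    (show (t - s) / (2 * t) + (t + s) / (2 * t) = 1 by field_simp; ring)
  have hpt : ((t - s) / (2 * t)) • (-t) + ((t + s) / (2 * t)) • t = s := by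
    simp only [smul_eq_mul]; field_simp; ring
  rw [hpt] at hconv
  simp only [smul_eq_mul, pressure_neg_field] at hconv
  have hsum : (t - s) / (2 * t) * pressure d β t + (t + s) / (2 * t) * pressure d β t = pressure d β t := by
    field_simp; ring
  dsimp only
  linarith

/-- **`ψ(β,h₁) ≤ ψ(β,h₂)` whenever `|h₁| ≤ |h₂|`** (every real `β`): the pressure depends on the field only through `|h|`
and increases with it. [cite: FriedliVelenik2017, Thm. 3.6 and §3.7.1] -/
theorem pressure_le_pressure_of_abs_le (β : ℝ) {h₁ h₂ : ℝ} (h12 : |h₁| ≤ |h₂|) :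
    pressure d β h₁ ≤ pressure d β h₂ := by
  have e1 : pressure d β h₁ = pressure d β |h₁| := by
    rcases le_or_gt 0 h₁ with h | h
    · rw [abs_of_nonneg h]
    · rw [abs_of_neg h, pressure_neg_field]
  have e2 : pressure d β h₂ = pressure d β |h₂| := by
    rcases le_or_gt 0 h₂ with h | h
    · rw [abs_of_nonneg h]
    · rw [abs_of_neg h, pressure_neg_field]
  rw [e1, e2]
  exact monotoneOn_pressure_field_abs (d := d) β (mem_Ici.2 (abs_nonneg _)) (mem_Ici.2 (abs_nonneg _)) h12

/-- **`log 2 = ψ(0,h) ≤ ψ(β,h)` and `ψ(β,0) ≤ ψ(β,h)`** packaged: for `β ≥ 0`, `ψ(β,0) ≤ ψ(β,h)` for every `h`.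
[cite: FriedliVelenik2017, Thm. 3.6 and §3.7.1] -/
theorem pressure_zero_field_le_pressure (β h : ℝ) : pressure d β 0 ≤ pressure d β h :=
  pressure_le_pressure_of_abs_le β (by simp)

end IsingPressure

end Summit.CriticalPhenomena.PercolationContinuityZ3.Theorems.FK

end
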